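import Summits.BirchSwinnertonDyer.BirchSwinnertonDyer.Theorems.AlignedTransportAtTwoBSDOfMainConjectureRankOneAtTwoSigmaSqTwoDworkGlue
import Summits.BirchSwinnertonDyer.BirchSwinnertonDyer.Theorems.AlignedTransportAtTwoBSDOfMainConjectureRankOneAtTwoSigmaSqTwoDomainFE
import HarnessLib

/-!
# The Dwork package of the `σ²`-at-`2` discharge over an ABSTRACT coefficient map `φ : A → K`: from an odd normalised solution `σ` on the
# chart curve `V^φ` and the Frobenius-model data to the hypotheses `hφ0, hφ, hu0, hu, heq` of the tree's Dwork lemma (steps S3–S6 of the plan for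
# the PRINT stub `stub_sigmaSqTwo` of crux C3′; route-independent)

Cell `bsd-f1-sign2`, WIDTH-5 attach seat `bsd-line-att-p3` g9 (`--supports stmt-BirchSwinnertonDyer-23008`; plan
`Cruxes/BSDOfMainConjectureRankOneAtTwo/SIGMASQ-AT-TWO-att-p3.md` §8–§9). THEOREMS ONLY. BSD is not proved by any of this.

Everything that `…SigmaSqTwoExistence.lean` needs over `K₂ = R̂₂[1/2]`, done once over an arbitrary `ℚ`-algebra domain `K`, a coefficient ring `A` with
`φ : A →+* K`, a Frobenius-type pair `α₀ : A → A`, `α : K → K` with `α ∘ φ = φ ∘ α₀`, the chart curve `V = ⟨1, B₂, 0, 0, g₂X₀²⟩/A` in the rational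
parametrisation of `…FrobeniusParam.lean`, `V^{α₀} = ⟨1, b₂′, 0, 0, b₆′⟩`, the fixed-point constant `4u₂²α₀(c) − 2c = 8δ`, `2·i₂ = 1` in `K`, and an odd
normalised solution `σ` of the sigma equation on `V^φ` with constant `φ(c)`:
**`frob_dwork_package`** — there are `T, V_D ∈ K⟦z⟧` with `T(0) = 0`, `[zⁿ]T = δ_{n,2} + 2a`, `V_D(0) = 1`, `[zⁿ⁺¹]V_D = 2a` (all `a ∈ φ(A)`) and
`(α_*H)(T) = H²·V_D` for `H = (σ/z)²` — by Vélu (`…VeluFormal/Transport`), the Frobenius model (`…FrobeniusModel`), the squared functional equation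
(`…DomainFE`), Dwork's shape (`…DworkShape`) and the closed forms / congruences (`…FrobeniusSeries`, `…DworkGlue`). Keeping this abstract keeps the
elaboration over the concrete `2`-adic completion small.

## Sources
C. Blakestad, D. Grant, J. Number Theory 249 (2023), Prop. 7, Lemma 12, Prop. 13 [cite: BlakestadGrant2023, Prop. 13]; J. Vélu, C. R. Acad. Sci. Paris 273 (1971)
[cite: SilvermanAEC2009, III.4]; N. Koblitz, GTM 58, Ch. IV §2 Lemma 3 [cite: Koblitz1984, Ch. IV §2 Lemma 3].
-/

noncomputable section

set_option linter.dupNamespace false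
set_option autoImplicit false

open scoped Classical
open PowerSeries WeierstrassCurve Literature.NumberTheory.EllipticCurves

namespace Summit.BirchSwinnertonDyer.BirchSwinnertonDyer.Theorems.AlignedTransportAtTwoSigmaSqTwo

/-- **The Dwork package** (see the module docstring). [cite: BlakestadGrant2023, Prop. 13] [cite: Koblitz1984, Ch. IV §2 Lemma 3] -/
theorem frob_dwork_package {A K : Type*} [CommRing A] [CommRing K] [Algebra ℚ K] [IsDomain K] (φ : A →+* K) (α₀ : A →+* A) (α : K →+* K)
    (hαφ : α.comp φ = φ.comp α₀) {B2 nu iq iu2 g2 X0 d c : A}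
    (hiq : 3 * ((1 + 4 * nu) ^ 2 - 4 * (1 + 4 * nu) - 16) * iq = 1) (hiu2 : (1 + 2 * B2) * iu2 = 1)
    (hg2 : g2 = (1 + 4 * B2) * (1 + nu) * iq) (hX0 : X0 = -1 - 4 * B2 - 64 * g2) (hd : d = -(1 + 4 * nu) * g2)
    (V : WeierstrassCurve A) (hV1 : V.a₁ = 1) (hV2 : V.a₂ = B2) (hV3 : V.a₃ = 0) (hV4 : V.a₄ = 0) (hV6 : V.a₆ = g2 * X0 ^ 2)
    (hVα₀ : V.map α₀ = ⟨1, (-48 * B2 ^ 2 * nu ^ 2 - 96 * B2 * nu ^ 2 + 24 * B2 ^ 2 * nu - 24 * nu ^ 2 - 72 * B2 * nu + 57 * B2 ^ 2 - 18 * nu +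
      24 * B2 + 6) * iq * iu2 ^ 2, 0, 0,
      (16384 * B2 ^ 3 * nu ^ 6 + 12288 * B2 ^ 2 * nu ^ 6 + 98304 * B2 ^ 3 * nu ^ 5 + 3072 * B2 * nu ^ 6 +
        73728 * B2 ^ 2 * nu ^ 5 + 227328 * B2 ^ 3 * nu ^ 4 + 256 * nu ^ 6 + 18432 * B2 * nu ^ 5 + 170496 * B2 ^ 2 * nu ^ 4 +
        262144 * B2 ^ 3 * nu ^ 3 + 1536 * nu ^ 5 + 42624 * B2 * nu ^ 4 + 196608 * B2 ^ 2 * nu ^ 3 + 158784 * B2 ^ 3 * nu ^ 2 +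
        3552 * nu ^ 4 + 49152 * B2 * nu ^ 3 + 119088 * B2 ^ 2 * nu ^ 2 + 47232 * B2 ^ 3 * nu + 4096 * nu ^ 3 + 29772 * B2 * nu ^ 2 +
        35424 * B2 ^ 2 * nu + 5184 * B2 ^ 3 + 2481 * nu ^ 2 + 8856 * B2 * nu + 3888 * B2 ^ 2 + 738 * nu + 972 * B2 + 81) *
        iq ^ 3 * iu2 ^ 6⟩)
    (hc : 4 * (1 + 2 * B2) ^ 2 * α₀ c - 2 * c = 2 * (4 * d)) {i2 : K} (hi2 : (2 : K) * i2 = 1)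
    {σ : K⟦X⟧} (hσ0 : constantCoeff σ = 0) (hσ1 : coeff 1 σ = 1) (hodd : (V.map φ).IsFormallyOdd σ)
    (hODE : (V.map φ).SatisfiesSigmaODE σ (φ c)) :
    ∃ T VD : K⟦X⟧, constantCoeff T = 0 ∧ (∀ n, ∃ a ∈ φ.range, coeff n T = (if n = 2 then 1 else 0) + ((2 : ℕ) : K) * a) ∧
      constantCoeff VD = 1 ∧ (∀ n, ∃ a ∈ φ.range, coeff (n + 1) VD = ((2 : ℕ) : K) * a) ∧
      (PowerSeries.map α (sigmaShift σ ^ 2)).subst T = (sigmaShift σ ^ 2) ^ 2 * VD := by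
  -- §1 the `K₂`-side data
  obtain ⟨VK, hVK⟩ : ∃ VK : WeierstrassCurve K, VK =
      V.map φ := ⟨_, rfl⟩
  have h1 : VK.a₁ = 1 := by rw [hVK, map_a₁, hV1, map_one]
  have h2 : VK.a₂ = φ B2 := by rw [hVK, map_a₂, hV2]
  have h3 : VK.a₃ = 0 := by rw [hVK, map_a₃, hV3, map_zero]
  have h4 : VK.a₄ = 0 := by rw [hVK, map_a₄, hV4, map_zero]
  have h6 : VK.a₆ = φ g2 * φ X0 ^ 2 := by rw [hVK, map_a₆, hV6, map_mul, map_pow]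
  have hX0K : φ X0 = -1 - 4 * φ B2 - 64 * φ g2 := by
    rw [hX0]; simp only [map_sub, map_neg, map_mul, map_one, map_ofNat]
  have hg2K : φ g2 = (1 + 4 * φ B2) * (1 + φ nu) * φ iq := by
    rw [hg2]; simp only [map_add, map_mul, map_one, map_ofNat]
  have hdK : φ d = -(1 + 4 * φ nu) * φ g2 := by
    rw [hd]; simp only [map_add, map_neg, map_mul, map_one, map_ofNat]
  have hiqK : 3 * ((1 + 4 * φ nu) ^ 2 - 4 * (1 + 4 * φ nu) - 16) * φ iq = 1 := by
    have h := congrArg φ hiq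
    simp only [map_sub, map_add, map_mul, map_pow, map_one, map_ofNat] at h
    exact h
  have hiu2K : (1 + 2 * φ B2) * φ iu2 = 1 := by
    have h := congrArg φ hiu2
    simp only [map_add, map_mul, map_one, map_ofNat] at h
    exact h
  -- Vélu's data for the canonical point `Q = (X₀/4, −X₀/8)`
  obtain ⟨e, he⟩ : ∃ e : K, e =
      φ X0 * i2 ^ 2 := ⟨_, rfl⟩
  obtain ⟨f, hf⟩ : ∃ f : K, f =
      -(φ X0 * i2 ^ 3) := ⟨_, rfl⟩
  obtain ⟨t, ht⟩ : ∃ t : K, t =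
      (3 * φ X0 ^ 2 + 8 * φ B2 * φ X0 + 2 * φ X0) * i2 ^ 4 := ⟨_, rfl⟩
  obtain ⟨hQ, h2t, ht'⟩ := frobModel_point VK h1 h2 h3 h4 h6 hX0K hi2 he hf ht
  obtain ⟨As, hA⟩ : ∃ As : PowerSeries K, As =
      VK.formalXMulSq - C e * X ^ 2 := ⟨_, rfl⟩
  obtain ⟨M, hM⟩ : ∃ M : PowerSeries K, M =
      VK.formalXMulSq * As + C t * X ^ 4 := ⟨_, rfl⟩
  obtain ⟨Dn, hDn⟩ : ∃ Dn : PowerSeries K, Dn =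
      VK.formalXMulSq * As ^ 2 + C t * X ^ 4 * (C VK.a₁ * X * As - VK.formalXMulSq - C f * X ^ 3) := ⟨_, rfl⟩
  have hDn0 : constantCoeff Dn = 1 := frob_constantCoeff_Dn VK hA hDn
  obtain ⟨uD, huD⟩ : ∃ uD : PowerSeries K, uD =
      invOfUnit Dn 1 := ⟨_, rfl⟩
  have hu : Dn * uD = 1 := by rw [huD]; exact mul_invOfUnit Dn 1 (by rw [hDn0, Units.val_one])
  obtain ⟨τ, hτ⟩ : ∃ τ : PowerSeries K, τ =
      X * As * M * uD := ⟨_, rfl⟩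
  obtain ⟨P, hP⟩ : ∃ P : PowerSeries K, P =
      As * M ^ 3 * uD ^ 2 := ⟨_, rfl⟩
  obtain ⟨hτ0, hτ1⟩ := frobModel_tau_coeff VK hA hM hDn hu hτ
  obtain ⟨V', hV'⟩ : ∃ V' : WeierstrassCurve K, V' =
      ⟨VK.a₁, VK.a₂, VK.a₃, VK.a₄ - 5 * t, VK.a₆ - VK.b₂ * t - 7 * e * t⟩ := ⟨_, rfl⟩
  have h1' : V'.a₁ = VK.a₁ := by rw [hV']
  have h2' : V'.a₂ = VK.a₂ := by rw [hV']
  have h3' : V'.a₃ = VK.a₃ := by rw [hV']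
  have h4' : V'.a₄ = VK.a₄ - 5 * t := by rw [hV']
  have h6' : V'.a₆ = VK.a₆ - VK.b₂ * t - 7 * e * t := by rw [hV']
  -- the Frobenius model `vc = [2u₂; R₁/4, u₂ − ½, −R₁/8]`
  have hvunit : (2 * (1 + 2 * φ B2)) * (i2 * φ iu2) = 1 := by
    linear_combination ((1 + 2 * φ B2) * φ iu2) * hi2 + hiu2K
  obtain ⟨vc, hvc⟩ : ∃ vc : VariableChange K, vc =
      ⟨Units.mkOfMulEqOne _ _ hvunit, (-φ X0 + 32 * φ d) * i2 ^ 2, (1 + 2 * φ B2) - i2,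
    -((-φ X0 + 32 * φ d) * i2 ^ 2) * i2⟩ := ⟨_, rfl⟩
  have hvu : (vc.u : K) = 2 * (1 + 2 * φ B2) := by
    rw [hvc]; exact Units.val_mkOfMulEqOne hvunit
  have hvr : vc.r = (-φ X0 + 32 * φ d) * i2 ^ 2 := by rw [hvc]
  have hvs : vc.s = (1 + 2 * φ B2) - i2 := by rw [hvc]
  have hvt : vc.t = -((-φ X0 + 32 * φ d) * i2 ^ 2) * i2 := by rw [hvc]
  obtain ⟨T, hT⟩ : ∃ T : PowerSeries K, T =
      (V'.formalVariableChange vc).subst τ := ⟨_, rfl⟩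
  have hT0 : constantCoeff T = 0 := frobModel_constantCoeff_T (K := K) hτ0 V' vc hT
  have hT1 : coeff 1 T = 2 * (1 + 2 * φ B2) := by rw [frobModel_coeff_one_T (K := K) hτ0 hτ1 V' vc hT, hvu]
  -- §2 the model is `𝓔^α`
  have hmodel' := frobModel_curve_map φ VK V' vc rfl rfl rfl rfl h1 h2 h3 h4 h6 hX0K hi2 hiqK hiu2K
    hg2K hdK he ht h1' h2' h3' h4' h6' hvu hvr hvs hvt
  have hEK : VK.map α = (V.map α₀).map φ := by
    rw [hVK, WeierstrassCurve.map_map, hαφ]; exact (V.map_map α₀ _).symm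
  have hmodel : vc • V' = VK.map α := by rw [hEK, hVα₀]; exact hmodel'
  -- §3 the odd normalised solution `σ_c` and its base change along `α`
  rw [← hVK] at hodd hODE
  obtain ⟨σ'', hσ''⟩ : ∃ σ'' : PowerSeries K, σ'' =
      PowerSeries.map α σ := ⟨_, rfl⟩
  obtain ⟨hσ0'', hσ1''⟩ := frob_map_normalised α hσ'' hσ0 hσ1
  have hodd'' : (vc • V').IsFormallyOdd σ'' := by rw [hmodel, hσ'']; exact isFormallyOdd_map_ringHom α hodd
  have hODE'' : (vc • V').SatisfiesSigmaODE σ'' (α (φ c)) := by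
    rw [hmodel, hσ'']; exact satisfiesSigmaODE_map_ringHom α hσ0 hσ1 hODE
  -- the constants relation `−r + u²·α(c) − 2c − e = 0` (the fixed point)
  have hκ : -vc.r + (vc.u : K) ^ 2 * α (φ c) - 2 * φ c - e = 0 := by
    have hcK := congrArg φ hc
    simp only [map_sub, map_mul, map_add, map_pow, map_one, map_ofNat] at hcK
    have hαc : α (φ c) = φ (α₀ c) := RingHom.congr_fun hαφ c
    rw [hvr, hvu, he, hαc, hdK]
    rw [hdK] at hcK
    linear_combination hcK + (-(8 * (-(1 + 4 * φ nu) * φ g2)) * (2 * i2 + 1)) * hi2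
  -- §4 the squared functional equation and Dwork's shape
  have hFE := velu_two_X_sq_mul_sq_subst_eq_domain VK hQ h2t ht' hA hM hDn hu hτ hP V' h1' h2' h3' h4' h6' vc hT hσ0 hσ1 hodd
    hODE hσ0'' hσ1'' hodd'' hODE'' hκ
  obtain ⟨μ, hμdef⟩ : ∃ μ : Kˣ, μ =
      Units.mkOfMulEqOne _ _ hiu2K := ⟨_, rfl⟩
  have hμ : (μ : K) = 1 + 2 * φ B2 := by
    rw [hμdef]; exact Units.val_mkOfMulEqOne hiu2K
  obtain ⟨Tn, hTn'⟩ : ∃ Tn : PowerSeries K, Tn =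
      C i2 * sigmaShift T := ⟨_, rfl⟩
  obtain ⟨hTn, hTn0⟩ := frob_sigmaShift_two (u2 := 1 + 2 * φ B2) hi2 hTn' hT1
  rw [← hμ] at hTn0
  have h2ne : (2 : K) ≠ 0 := fun h => by rw [h, zero_mul] at hi2; exact zero_ne_one hi2
  have hFE' : X ^ 2 * σ''.subst T ^ 2 = C (2 * (μ : K)) ^ 2 * σ ^ 4 * As := by
    rw [hFE, hvu, hμ, hA]
  have hshape := dworkShape_of_sq_functionalEquation_unit h2ne μ hσ0 hσ0'' hT0 hTn hTn0 hFE'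
  obtain ⟨H, hH⟩ : ∃ H : PowerSeries K, H =
      sigmaShift σ ^ 2 := ⟨_, rfl⟩
  obtain ⟨VD, hVD⟩ : ∃ VD : PowerSeries K, VD =
      C ((μ : K) ^ 2) * As * invOfUnit (Tn ^ 2) (μ ^ 2) := ⟨_, rfl⟩
  have hmapH := frob_map_sigmaShift_sq α hσ'' hH
  have heq : (PowerSeries.map α H).subst T = H ^ 2 * VD := by rw [hmapH, hH, hVD]; exact hshape
  -- §5 integrality: the closed forms over `R̂₂` and their images in `K₂`
  obtain ⟨cAR, hcAR⟩ : ∃ cAR : PowerSeries A, cAR =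
      4 * V.formalXMulSq - C X0 * X ^ 2 := ⟨_, rfl⟩
  obtain ⟨cUR, hcUR⟩ : ∃ cUR : PowerSeries A, cUR =
      V.formalXMulSq ^ 2 - 8 * C d * V.formalXMulSq * X ^ 2 + 2 * (C d * C X0 - 4 * C g2 * C X0) * X ^ 4 := ⟨_, rfl⟩
  obtain ⟨cQR, hcQR⟩ : ∃ cQR : PowerSeries A, cQR =
      V.formalXMulSq ^ 2 - 16 * C g2 * V.formalXMulSq * X ^ 2 - 4 * C g2 * C X0 * X ^ 4 := ⟨_, rfl⟩
  obtain ⟨cGR, hcGR⟩ : ∃ cGR : PowerSeries A, cGR =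
      (-C B2 - 32 * C g2) * V.formalXMulSq ^ 2 - 4 * (1 + 2 * C B2) * C d * V.formalXMulSq * X ^ 2 +
      (1 + 2 * C B2) * (C d * C X0 - 4 * C g2 * C X0) * X ^ 4 - 8 * C g2 * C X0 * V.formalXMulSq * X ^ 2 - 2 * C g2 * C X0 ^ 2 * X ^ 4 := ⟨_, rfl⟩
  obtain ⟨cDR, hcDR⟩ : ∃ cDR : PowerSeries A, cDR =
      (1 + 2 * C B2) * X * V.formalXMulSq * cUR + V.formalXMulSq ^ 2 * cQR + 8 * C g2 * C X0 * X ^ 4 * cQR -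
      X ^ 2 * V.formalXMulSq * cGR := ⟨_, rfl⟩
  obtain ⟨N2R, hN2R⟩ : ∃ N2R : PowerSeries A, N2R =
      (1 + 2 * C B2) * X * (2 - X) * V.formalXMulSq * cUR := ⟨_, rfl⟩
  have h2I : (2 : A) ∈ Ideal.span {(2 : A)} := Ideal.mem_span_singleton_self _
  have hN2m := frob_coeff_N2_sub_mem V (Ideal.span {(2 : A)}) h2I hV1 hV2 hV3 hV4 hV6 hX0 hd hcUR hcQR hcGR hcDR
  have hV4m := frob_coeff_calD_sq_sub_mem V (Ideal.span {(2 : A)}) h2I hV1 hV2 hV3 hV4 hV6 hX0 hd hcUR hcQR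
    hcGR hcDR
  obtain ⟨hU0R, hQ0R, hD0R⟩ := frob_constantCoeff V hcUR hcQR hcDR
  -- the same series over `K₂`
  -- the same series over `K₂`
  obtain ⟨cAK, hcAK⟩ : ∃ cAK : PowerSeries K, cAK =
      4 * VK.formalXMulSq - C (φ X0) * X ^ 2 := ⟨_, rfl⟩
  obtain ⟨cUK, hcUK⟩ : ∃ cUK : PowerSeries K, cUK =
      VK.formalXMulSq ^ 2 - 8 * C (φ d) * VK.formalXMulSq * X ^ 2 +
        2 * (C (φ d) * C (φ X0) - 4 * C (φ g2) * C (φ X0)) * X ^ 4 := ⟨_, rfl⟩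
  obtain ⟨cQK, hcQK⟩ : ∃ cQK : PowerSeries K, cQK =
      VK.formalXMulSq ^ 2 - 16 * C (φ g2) * VK.formalXMulSq * X ^ 2 - 4 * C (φ g2) * C (φ X0) * X ^ 4 := ⟨_, rfl⟩
  obtain ⟨cGK, hcGK⟩ : ∃ cGK : PowerSeries K, cGK =
      (-C (φ B2) - 32 * C (φ g2)) * VK.formalXMulSq ^ 2 -
        4 * (1 + 2 * C (φ B2)) * C (φ d) * VK.formalXMulSq * X ^ 2 +
        (1 + 2 * C (φ B2)) * (C (φ d) * C (φ X0) - 4 * C (φ g2) * C (φ X0)) * X ^ 4 -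
        8 * C (φ g2) * C (φ X0) * VK.formalXMulSq * X ^ 2 - 2 * C (φ g2) * C (φ X0) ^ 2 * X ^ 4 := ⟨_, rfl⟩
  obtain ⟨cDK, hcDK⟩ : ∃ cDK : PowerSeries K, cDK =
      (1 + 2 * C (φ B2)) * X * VK.formalXMulSq * cUK + VK.formalXMulSq ^ 2 * cQK +
        8 * C (φ g2) * C (φ X0) * X ^ 4 * cQK - X ^ 2 * VK.formalXMulSq * cGK := ⟨_, rfl⟩
  obtain ⟨hmapA, hmapU, hmapQ, hmapG, hmapD, hmapN⟩ := frob_map_series φ V VK hVK hcAR hcUR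
    hcQR hcGR hcDR hcAK hcUK hcQK hcGK hcDK
  -- `T·𝔇 = N₂` and `V = 𝔇²/(𝒬𝒰²)` over `K₂`
  have hTD := frobModel_T_mul_calD VK V' vc h1 h2 h3 h4 h6 hX0K hi2 he hf ht hA hM hDn hu hτ h1' h2' h3' h4' h6' hvu hvr hvs hvt hT
    hcAK hcUK hcQK hcGK hcDK
  have hA' := frob_A_normalForm hA he
  have hT2K := frob_calA_mul_calQ VK h1 h2 h3 h4 h6 hX0K hcAK hcQK
  obtain ⟨hU0K, hQ0K, -⟩ := frob_constantCoeff VK hcUK hcQK hcDK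
  have hVeq := frobModel_V_eq VK μ hi2 hμ hA' hcAK hT2K hQ0K hU0K hT0 hT1 hTn hTD
  -- `T` and `V` come from `R̂₂⟦z⟧`
  obtain ⟨invD, hinvD⟩ : ∃ invD : PowerSeries A, invD =
      invOfUnit cDR 1 := ⟨_, rfl⟩
  have hinvD1 : cDR * invD = 1 := by rw [hinvD]; exact mul_invOfUnit cDR 1 (by rw [hD0R, Units.val_one])
  obtain ⟨TR, hTR⟩ : ∃ TR : PowerSeries A, TR =
      N2R * invD := ⟨_, rfl⟩
  rw [hN2R] at hTR
  have hTmap := frob_T_eq_map φ hTD hmapD hmapN hinvD1 hTR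
  obtain ⟨invQ, hinvQ⟩ : ∃ invQ : PowerSeries A, invQ =
      invOfUnit (cQR * cUR ^ 2) 1 := ⟨_, rfl⟩
  obtain ⟨VR, hVR⟩ : ∃ VR : PowerSeries A, VR =
      cDR ^ 2 * invQ := ⟨_, rfl⟩
  have hVeq' : VD = cDK ^ 2 * invOfUnit (cQK * cUK ^ 2) 1 := by rw [hVD]; exact hVeq
  have hVmap := frob_V_eq_map φ hVeq' hmapD hmapQ hmapU hQ0R hU0R hinvQ hVR
  -- §6 the package
  have hφ := frob_dwork_hφ φ hinvD1 hTR hN2m hTmap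
  obtain ⟨hu0, hu⟩ := frob_dwork_hu φ hQ0R hU0R hD0R hinvQ hVR hV4m hVmap
  refine ⟨T, VD, hT0, hφ, hu0, hu, ?_⟩
  rw [← hH]; exact heq

end Summit.BirchSwinnertonDyer.BirchSwinnertonDyer.Theorems.AlignedTransportAtTwoSigmaSqTwo
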